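import Summits.Ventures.HSemireg.WedgeHankelRecurrenceGaussLaguerreExample

/-!
# Venture HSemireg — **JACOBI'S THEOREM ON THE DEGREE OF EXACTNESS (general form)**: a `(t+1)`-point rule with distinct nodes `v` and weights `μ` is exact in degree `≤ t` against the
# discrete data `(ν, w)` iff it is INTERPOLATORY (`μ_k = Σ_l ν_l ℓ_k(w_l)`); and it is exact in degree `≤ t + 1 + s` IFF it is interpolatory AND its node polynomial `ω = ∏ (X − v_j)` is
# `(ν, w)`-orthogonal to every polynomial of degree `≤ s` — N262's Gauss–Jacobi `↔` (`s = t`) at every intermediate degree (Radau `s = t − 1`, Lobatto `s = t − 2`, Kronrod …)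

HONEST FRAMING. Part of the Lean index of the computation cell `pub-hsemireg` (seat p10 gen 46, Sunday typer «UNIFORM-IN-n»).  Real polynomials and finite sums only (Mathlib `Lagrange.basis`,
`Polynomial.modByMonic`); no variety, no cohomology theory, no sheaf, no Ext group and no semiregularity map is constructed here; nothing here says that HC / HC_CM / HC_AV holds; no Literature
fact (unproved `Prop`) is declared or used.  Custodian versions as in `WedgeHankelSiegelIdeal` (1/3).
SOURCES (cited).  C. G. J. Jacobi, *Ueber Gauß' neue Methode, die Werthe der Integrale näherungsweise zu finden*, J. reine angew. Math. 1 (1826) 301–308; W. Gautschi, *Orthogonal Polynomials: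
Computation and Approximation* (2004), Thm 1.45 (degree of exactness `d = n − 1 + k` iff interpolatory and `ω_n ⊥ ℙ_{k−1}`) and §3.1.1–3.1.2; P. J. Davis, P. Rabinowitz, *Methods of
Numerical Integration* (2nd ed. 1984), §2.7; G. Szegő, *Orthogonal Polynomials*, Thm 3.4.1.
PROOF TYPED HERE.  Interpolatory exactness: expand `F` (`deg ≤ t`) in the Lagrange basis (N262 `sum_mul_eval_eq_sum_eval_mul_sum_basis`).  Degree `t + 1 + s`: write `F = ω (F ∕ₘ ω) + F %ₘ ω`
with `deg (F ∕ₘ ω) ≤ s`, kill `ω` on the nodes and by orthogonality on the data side; conversely exactness on `ω G` gives orthogonality and on `ℓ_k` the weights (N262's lemmas with the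
moment range adjusted).
DEDUP DISCLOSURE (`rg -n 'jacobi_degree|interpolatory_exact|exact_of_orthogonal' Summits/Ventures/HSemireg`, 2026-09-03): N262 `gauss_jacobi_iff` ∕ `sum_mul_eval_eq_of_orthogonal` are the case
`s = t` (degree `2t + 1`); N277 ∕ N278 (Radau ∕ Lobatto) prove their exactness ad hoc.  The general-`s` statements are new.  The 4 names below: 0 hits tree-wide.

WHAT IS IN THE TREE.  N262 `sum_mul_eval_eq_sum_eval_mul_sum_basis`, `gauss_weight_eq_sum_mul_eval_basis`, `sum_mul_eval_eq_of_moments_eq` (N259); Mathlib `Polynomial.modByMonic_add_div`,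
`natDegree_modByMonic_lt`, `natDegree_divByMonic`.
THIS FILE (namespace `Summit.Ventures.HSemireg.Wedge.HankelOuter` continued; CHAINED on N376 (import only); 0 definitions):
* §1142 **`interpolatory_exact`** (interpolatory weights ⇒ exact in degree `≤ t`), **`jacobi_exact_of_orthogonal`** (interpolatory + `ω ⊥ ℙ_s` ⇒ exact in degree `≤ t + 1 + s`),
  `orthogonal_of_exact` (exact in degree `≤ t + 1 + s` ⇒ `ω ⊥ ℙ_s`), **`jacobi_degree_iff`** (JACOBI: moments up to `t + 1 + s` agree ⇔ `ω ⊥ ℙ_s` ∧ interpolatory weights).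
CAVEATS.  Discrete integrating data `(ν, w)` as everywhere in this lineage; `s ≤ t` is not needed for the statements (for `s > t` the orthogonality hypothesis is simply unsatisfiable when
`ν > 0` and enough `w_l` are distinct — N263 `gauss_defect_pos`).  Nothing Ext-side.  New names only.
-/

open Module Polynomial
open scoped Matrix Polynomial

namespace Summit.Ventures.HSemireg.Wedge.HankelOuter

/-! ## §1142. Jacobi's theorem on the degree of exactness -/

/-- **INTERPOLATORY RULES ARE EXACT IN DEGREE `≤ t`**: if `μ_k = Σ_l ν_l ℓ_k(w_l)` for the Lagrange basis `ℓ_k` of the `t + 1` distinct nodes `v`, then `Σ_j μ_j F(v_j) = Σ_l ν_l F(w_l)` whenever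
`deg F ≤ t`. [Davis–Rabinowitz §2.7; Gautschi Thm 1.45; this file, §1142] -/
theorem interpolatory_exact {t N : ℕ} {μ v : Fin (t + 1) → ℝ} {ν w : Fin N → ℝ} (hv : Function.Injective v)
    (hμ : ∀ k, μ k = ∑ l, ν l * (Lagrange.basis Finset.univ v k).eval (w l)) {F : ℝ[X]} (hF : F.natDegree ≤ t) :
    ∑ j, μ j * F.eval (v j) = ∑ l, ν l * F.eval (w l) := by
  rw [sum_mul_eval_eq_sum_eval_mul_sum_basis hv ν w hF]
  exact Finset.sum_congr rfl fun k _ => by rw [hμ k, mul_comm]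

/-- **JACOBI (⇐): interpolatory weights and `ω ⊥ ℙ_s` give exactness in degree `≤ t + 1 + s`.** [Jacobi 1826; Gautschi Thm 1.45; this file, §1142] -/
theorem jacobi_exact_of_orthogonal {t N s : ℕ} {μ v : Fin (t + 1) → ℝ} {ν w : Fin N → ℝ} (hv : Function.Injective v)
    (horth : ∀ G : ℝ[X], G.natDegree ≤ s → ∑ l, ν l * ((∏ j, (Polynomial.X - C (v j))) * G).eval (w l) = 0)
    (hμ : ∀ k, μ k = ∑ l, ν l * (Lagrange.basis Finset.univ v k).eval (w l)) {F : ℝ[X]} (hF : F.natDegree ≤ t + 1 + s) :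
    ∑ j, μ j * F.eval (v j) = ∑ l, ν l * F.eval (w l) := by
  set q : ℝ[X] := ∏ j, (Polynomial.X - C (v j)) with hq
  have hqm : q.Monic := monic_prod_of_monic _ _ fun j _ => monic_X_sub_C (v j)
  have hqdeg : q.natDegree = t + 1 := by
    rw [hq, natDegree_prod_of_monic _ _ fun j _ => monic_X_sub_C (v j)]
    simp only [natDegree_X_sub_C, Finset.sum_const, Finset.card_univ, Fintype.card_fin, smul_eq_mul, mul_one]
  have hdiv : F %ₘ q + q * (F /ₘ q) = F := modByMonic_add_div F q
  have hq1 : q ≠ 1 := fun h1 => by rw [h1, natDegree_one] at hqdeg; omega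
  have hRdeg : (F %ₘ q).natDegree ≤ t := by
    have := natDegree_modByMonic_lt F hqm hq1
    rw [hqdeg] at this; omega
  have hGdeg : (F /ₘ q).natDegree ≤ s := by
    rw [natDegree_divByMonic F hqm, hqdeg]; omega
  have hq0 : ∀ j, q.eval (v j) = 0 := fun j => by
    rw [hq, eval_prod]; exact Finset.prod_eq_zero (Finset.mem_univ j) (by simp)
  have hsmall : ∑ j, μ j * F.eval (v j) = ∑ j, μ j * (F %ₘ q).eval (v j) := by
    refine Finset.sum_congr rfl fun j _ => ?_
    conv_lhs => rw [← hdiv]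
    rw [eval_add, eval_mul, hq0 j, zero_mul, add_zero]
  have hbig : ∑ l, ν l * F.eval (w l) = ∑ l, ν l * (F %ₘ q).eval (w l) := by
    have h1 : ∑ l, ν l * F.eval (w l) = ∑ l, ν l * (F %ₘ q).eval (w l) + ∑ l, ν l * (q * (F /ₘ q)).eval (w l) := by
      rw [← Finset.sum_add_distrib]
      refine Finset.sum_congr rfl fun l _ => ?_
      conv_lhs => rw [← hdiv]
      rw [eval_add]; ring
    rw [h1, horth _ hGdeg, add_zero]
  rw [hsmall, hbig]
  exact interpolatory_exact hv hμ hRdeg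

/-- **JACOBI (⇒, orthogonality): exactness in degree `≤ t + 1 + s` (moment form) forces `ω ⊥ ℙ_s`.** [Jacobi 1826; this file, §1142] -/
theorem orthogonal_of_exact {t N s : ℕ} {μ v : Fin (t + 1) → ℝ} {ν w : Fin N → ℝ}
    (hmom : ∀ p, p ≤ t + 1 + s → ∑ j, μ j * v j ^ p = ∑ l, ν l * w l ^ p) {G : ℝ[X]} (hG : G.natDegree ≤ s) :
    ∑ l, ν l * ((∏ j, (Polynomial.X - C (v j))) * G).eval (w l) = 0 := by
  have hqdeg : (∏ j, (Polynomial.X - C (v j))).natDegree = t + 1 := by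
    rw [natDegree_prod_of_monic _ _ fun j _ => monic_X_sub_C (v j)]
    simp only [natDegree_X_sub_C, Finset.sum_const, Finset.card_univ, Fintype.card_fin, smul_eq_mul, mul_one]
  have hdeg : ((∏ j, (Polynomial.X - C (v j))) * G).natDegree < t + 2 + s := by
    refine lt_of_le_of_lt natDegree_mul_le ?_
    rw [hqdeg]; omega
  rw [← sum_mul_eval_eq_of_moments_eq (N := t + 2 + s) (fun p hp => hmom p (by omega)) hdeg]
  refine Finset.sum_eq_zero fun j _ => ?_
  rw [eval_mul, eval_prod, Finset.prod_eq_zero (Finset.mem_univ j) (by simp), zero_mul, mul_zero]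

/-- **JACOBI'S THEOREM (general degree) as an `↔`**: a `(t+1)`-point rule with distinct nodes `v` matches the moments of `(ν, w)` up to order `t + 1 + s` IFF its node polynomial is orthogonal to
`ℙ_s` and its weights are the interpolatory ones `Σ_l ν_l ℓ_k(w_l)`. [Jacobi 1826; Gautschi Thm 1.45; Szegő Thm 3.4.1 (`s = t`); this file, §1142] -/
theorem jacobi_degree_iff {t N s : ℕ} {μ v : Fin (t + 1) → ℝ} {ν w : Fin N → ℝ} (hv : Function.Injective v) :
    (∀ p, p ≤ t + 1 + s → ∑ j, μ j * v j ^ p = ∑ l, ν l * w l ^ p) ↔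
      (∀ G : ℝ[X], G.natDegree ≤ s → ∑ l, ν l * ((∏ j, (Polynomial.X - C (v j))) * G).eval (w l) = 0) ∧
        ∀ k, μ k = ∑ l, ν l * (Lagrange.basis Finset.univ v k).eval (w l) := by
  constructor
  · intro hmom
    exact ⟨fun G hG => orthogonal_of_exact hmom hG, fun k => gauss_weight_eq_sum_mul_eval_basis hv (fun p hp => hmom p (by omega)) k⟩
  · rintro ⟨horth, hμ⟩ p hp
    have h := jacobi_exact_of_orthogonal hv horth hμ (F := Polynomial.X ^ p) (by rw [natDegree_X_pow]; exact hp)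
    simpa only [eval_pow, eval_X] using h

end Summit.Ventures.HSemireg.Wedge.HankelOuter
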